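import Summits.Ventures.LatticeQCDFlow.Scaling.EntryStarGapLaw

/-!
HONEST FRAMING: exact (Metropolis-corrected) sampling algorithms for lattice gauge theory; figures
of merit are autocorrelation/cost numbers at stated couplings and volumes; no continuum-physics
claim.

# TightSectorGapLaw — THE MAP QUALITY IS PAID EXACTLY ONCE: FOR A SECTOR `A` PRESERVED BY THE ENTRY MAPS WHOSE HOT MASS IS AT MOST
# `p'` TIMES ITS COLD MASS `θ`, `p·min{ct/(3m), (1−t)w_0/(7K)} ≤ Gap ≤ (p'/(1−θ))·min{t/K, (1−t)w_0/K}`; ONE-SIDED DOMINATION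
# FORCES `p ≤ p'` AND ALLOWS `p' = p`, SO THE QUADRATIC THEORY OF THE MAP-ASSISTED HUB IS LINEAR IN THE QUALITY FROM BOTH SIDES;
# `t_rel ≥ (1−θ)K/(p'·min{t, (1−t)w_0})`; AT HALF SWAPS ONE RELAXATION TIME COSTS BETWEEN `(1−θ)K(κ_s+κ_u)/p'` AND
# `7K(κ_s+κ_u)/p` (lean-2 GEN-29, ours)

Venture-side (OURS).  Cell `lqcd-flow` (pub-lqcd), unit `pub-lqcd-lean-2-g29`, 2026-08-28.  Chapter O (the floor sees the map
quality), file 1.  `HOME/lean-2/OPEN-MATH-chapterM.md` item 8 left open whether the factor `1/p` of every chapter-N ceiling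
(`Scaling/DominatedStarRegimeFree{Gap, Relaxation, Cost}`: `Gap, γ⋆ ≥ G = p·min{ct/(3m), (1−t)w_0/(7K)}`) is necessary: the floors of
chapters K and N (`Scaling/AllocationCostLaw`, `Scaling/EntryStarGapLaw`: `Gap ≤ min{t/(2Kv), (1−t)w_0·μ_0(A)μ_0(Aᶜ)/((K+1)v)}`) were
read "up to `p` and `v`".  This file reads chapter K's two test functions — the diluted handover of `Scaling/SwapGraphDilution`
(`Gap ≤ t·h·min{μ_0(A),μ_0(Aᶜ)}/(mKv)`, `v` bounding the COLD sector balances only) and the full sector count of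
`Scaling/ExchangeSchemeHandoverCeiling` (`Gap ≤ (1−t)Σ_k w_kQ_k(A,Aᶜ)/Σ_kμ_k(A)μ_k(Aᶜ)`) — at a TIGHT sector: every cold level gives
the sector `A` the same mass `θ ∈ (0,1)` and the hot level gives it at most `p'·θ`.  Summing the one-sided transported domination
`p·μ_{κ_r+1}(φ_r u) ≤ μ_0(u)` over `A` (the maps preserve `A`) gives `p·θ ≤ μ_0(A)`, so `p ≤ p'` always, and `p' = p` exactly when the
domination is attained on all of `A` — allowed (e.g. two points, `μ_k = (θ, 1−θ)`, `μ_0 = (pθ, 1−pθ)`, identity maps).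

Setting: scheme `P = t·GSw + (1−t)·Π_w^M` on `S^{Fin (K+1)}`, hub list `e_r = (0, κ_r+1)` with every cold level listed `≥ c ≥ 1` times,
entry maps `φ_r` preserving `A`, exact hot redraws, `μ_k`-reversible cold kernels SECTOR-IDLE for `A` (`w_k·Q_k(A,Aᶜ) = 0`, `k ≠ 0`).

## What is proved

* §0 `sector_coldMass_le_hotMass` — `p·μ_{κ_r+1}(A) ≤ μ_0(A)` for every entry `r`; `tightSector_floor_le_ceiling` — `p ≤ p'`.
* §1 **`tightSector_spectralGap_le_swap`** — `Gap ≤ t·p'/(K(1−θ))` (any `0 ≤ t ≤ 1`, any probability vector `w`, any hot kernel);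
  **`tightSector_spectralGap_le_hot`** — exact hot redraws: `Gap ≤ (1−t)w_0·p'/(K(1−θ))`.
* §2 **`tightSector_spectralGap_two_sided` (THE LAW):** `0 < t < 1`, `w_0 > 0`, one-sided domination `p ∈ (0,1]`:
  **`p·min{ct/(3m), (1−t)w_0/(7K)} ≤ Gap ≤ (p'/(K(1−θ)))·min{t, (1−t)w_0}`**;
  **`uniformTightSector_spectralGap_two_sided`** — `m = cK`: `(p/K)·min{t/3, (1−t)w_0/7} ≤ Gap ≤ (p'/(K(1−θ)))·min{t, (1−t)w_0}`.
* §3 **`tightSector_relaxationTime_ge`** — `t_rel ≥ (1−θ)K/(p'·min{t, (1−t)w_0})`;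
  **`halfStar_tightSector_relaxationCost_two_sided`** — `t = ½`, `w_0 = 1`, `m = cK`: `(1−θ)K(κ_s+κ_u)/p' ≤ ((κ_s+κ_u)/2)·t_rel ≤ 7K(κ_s+κ_u)/p`.

Reading (no numerics implied): OPEN-MATH item 8's missing `1/p` on the floor side is supplied, on the quadratic side, by the sectors chapter
K already used — a topological sector the hot level visits `p'` times as rarely as the cold ones is exactly a set on which the transport is
tight —: the gap, the absolute gap, the relaxation time and the cost of one relaxation of the map-assisted hot-refreshed hub are `Θ(1/p)`
from both sides at fixed swap fraction, with no regime; item 5's `τ_int = Θ(m/(cp))` at a `p`-independent swap fraction is therefore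
achieved (N3) AND unimprovable in `p`.  NOT CLAIMED: the distance profile / `log K` (item 1); instances where the hot level covers every
map-invariant sector better than `p` (then `p' < ` the pointwise constant and the ceiling is weaker, correctly); anything measured.
Literature grade (cell rule): OWN COROLLARY (chapter K's ceilings + N2/N4/N5); nothing cited as a fact; no new bib keys.
-/

noncomputable section

open Finset Function
open Literature.Probability.MarkovChains

namespace Summit.Ventures.LatticeQCDFlow.Scaling

variable {S : Type*} [Fintype S] [DecidableEq S] {K m : ℕ} {μ : Fin (K + 1) → S → ℝ} {M : Fin (K + 1) → S → S → ℝ}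
  {w : Fin (K + 1) → ℝ} {t p : ℝ}

section Sector
variable (κ : Fin m → Fin K) (φ : Fin m → Equiv.Perm S)

/-! ## §0 One-sided domination summed over an invariant sector -/

omit [Fintype S] [DecidableEq S] in
/-- **`p·μ_{κ_r+1}(A) ≤ μ_0(A)`:** one-sided transported domination summed over a sector preserved by the entry map (which permutes
`A`). [ours] -/
theorem sector_coldMass_le_hotMass (hdom : ∀ r u, p * μ (κ r).succ (φ r u) ≤ μ 0 u) {A : Finset S}
    (hφA : ∀ r u, φ r u ∈ A ↔ u ∈ A) (r : Fin m) :
    p * ∑ u ∈ A, μ (κ r).succ u ≤ ∑ u ∈ A, μ 0 u := by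
  have h1 : ∑ u ∈ A, μ (κ r).succ (φ r u) = ∑ u ∈ A, μ (κ r).succ u :=
    Finset.sum_nbij' (fun u => φ r u) (fun u => (φ r).symm u) (fun u hu => (hφA r u).2 hu)
      (fun u hu => by
        have h := hφA r ((φ r).symm u)
        rw [Equiv.apply_symm_apply] at h
        exact h.1 hu)
      (fun u _ => Equiv.symm_apply_apply _ _) (fun u _ => Equiv.apply_symm_apply _ _) (fun u _ => rfl)
  rw [← h1, mul_sum]
  exact sum_le_sum fun u _ => hdom r u

omit [Fintype S] [DecidableEq S] in
/-- **THE CEILING NEVER UNDERCUTS THE FLOOR: `p ≤ p'`** whenever some listed cold level gives the sector mass `θ > 0` and the hot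
level gives it at most `p'θ`. [ours] -/
theorem tightSector_floor_le_ceiling (hm : 1 ≤ m) (hdom : ∀ r u, p * μ (κ r).succ (φ r u) ≤ μ 0 u) {A : Finset S}
    (hφA : ∀ r u, φ r u ∈ A ↔ u ∈ A) {θ p' : ℝ} (hθ0 : 0 < θ)
    (hcold : ∀ k : Fin (K + 1), k ≠ 0 → ∑ u ∈ A, μ k u = θ) (hhot : ∑ u ∈ A, μ 0 u ≤ p' * θ) : p ≤ p' := by
  have h := sector_coldMass_le_hotMass κ φ hdom hφA ⟨0, hm⟩
  rw [hcold _ (Fin.succ_ne_zero _)] at h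
  exact le_of_mul_le_mul_right (h.trans hhot) hθ0

/-! ## §1 The two ceilings at a tight sector -/

omit [DecidableEq S] in
/-- Cold sector balance at a tight sector: `μ_k(A)·μ_k(Aᶜ) = θ(1−θ)` for `k ≠ 0`. [ours] -/
theorem tightSector_coldBalance_eq [DecidableEq S] (hμ1 : ∀ k, ∑ u, μ k u = 1) {A : Finset S} {θ : ℝ}
    (hcold : ∀ k : Fin (K + 1), k ≠ 0 → ∑ u ∈ A, μ k u = θ) (k : Fin (K + 1)) (hk : k ≠ 0) :
    (∑ u ∈ A, μ k u) * ∑ u ∈ Aᶜ, μ k u = θ * (1 - θ) := by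
  have hsum : ∑ u ∈ A, μ k u + ∑ u ∈ Aᶜ, μ k u = 1 := by rw [Finset.sum_add_sum_compl, hμ1 k]
  rw [hcold k hk] at hsum ⊢
  rw [show ∑ u ∈ Aᶜ, μ k u = 1 - θ by linarith]

/-- **THE SWAP CEILING AT A TIGHT SECTOR: `Gap ≤ t·p'/(K(1−θ))`** — chapter K's diluted handover `t·h·min{μ_0(A),μ_0(Aᶜ)}/(mKv)` with hot
degree `h = m` (every entry of the hub list touches level `0`), `min{μ_0(A),μ_0(Aᶜ)} ≤ μ_0(A) ≤ p'θ` and `v = θ(1−θ)`; any `0 ≤ t ≤ 1`, any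
probability vector `w`, any `μ_0`-reversible hot kernel, sector-idle reversible cold kernels. [ours] -/
theorem tightSector_spectralGap_le_swap [Nontrivial S] (hK : 1 ≤ K) (hm : 1 ≤ m) (hμ : ∀ k x, 0 < μ k x)
    (hμ1 : ∀ k, ∑ u, μ k u = 1) (hM : ∀ k, IsRowStochastic (M k)) (hMrev : ∀ k, DetailedBalance (μ k) (M k))
    (hw0 : ∀ k, 0 ≤ w k) (hw1 : ∑ k, w k = 1) (ht0 : 0 ≤ t) (ht1 : t ≤ 1)
    {A : Finset S} (hφA : ∀ r u, φ r u ∈ A ↔ u ∈ A) {θ p' : ℝ} (hθ0 : 0 < θ) (hθ1 : θ < 1)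
    (hcold : ∀ k : Fin (K + 1), k ≠ 0 → ∑ u ∈ A, μ k u = θ) (hhot : ∑ u ∈ A, μ 0 u ≤ p' * θ)
    (hidle : ∀ k : Fin (K + 1), k ≠ 0 → w k * edgeMeasure (μ k) (M k) A Aᶜ = 0) :
    spectralGap (tensorFun μ) (fun y z : Fin (K + 1) → S =>
        t * ptGraphSwap μ (fun r : Fin m => (((0 : Fin (K + 1)), (κ r).succ) : Fin (K + 1) × Fin (K + 1))) φ y z
          + (1 - t) * prodKernel w M y z) ≤ t * p' / (K * (1 - θ)) := by
  have hKpos : (0 : ℝ) < K := Nat.cast_pos.mpr (by omega)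
  have hmpos : (0 : ℝ) < m := Nat.cast_pos.mpr (by omega)
  have h1θ : 0 < 1 - θ := by linarith
  have he : ∀ r : Fin m, ((fun r : Fin m => (((0 : Fin (K + 1)), (κ r).succ) : Fin (K + 1) × Fin (K + 1))) r).1
      ≠ ((fun r : Fin m => (((0 : Fin (K + 1)), (κ r).succ) : Fin (K + 1) × Fin (K + 1))) r).2 :=
    fun r => (Fin.succ_ne_zero (κ r)).symm
  have hv : ∀ k : Fin (K + 1), k ≠ 0 → θ * (1 - θ) ≤ (∑ u ∈ A, μ k u) * ∑ u ∈ Aᶜ, μ k u :=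
    fun k hk => (tightSector_coldBalance_eq hμ1 hcold k hk).ge
  have h := dilutedHandover_spectralGap_le hK hm he hμ hμ1 hM hMrev hw0 hw1 ht0 ht1 hφA (mul_pos hθ0 h1θ) hv hidle
  refine h.trans ?_
  -- hot degree `≤ m`, `min{μ_0(A), μ_0(Aᶜ)} ≤ μ_0(A) ≤ p'θ`
  have hdeg : ((univ.filter fun r : Fin m =>
      ((fun r : Fin m => (((0 : Fin (K + 1)), (κ r).succ) : Fin (K + 1) × Fin (K + 1))) r).1 = 0 ∨
        ((fun r : Fin m => (((0 : Fin (K + 1)), (κ r).succ) : Fin (K + 1) × Fin (K + 1))) r).2 = 0).card : ℝ) ≤ m := by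
    exact_mod_cast (Finset.card_filter_le _ _).trans (by rw [Finset.card_univ, Fintype.card_fin])
  have hmin : min (∑ u ∈ A, μ 0 u) (∑ u ∈ Aᶜ, μ 0 u) ≤ p' * θ := (min_le_left _ _).trans hhot
  have hmin0 : 0 ≤ min (∑ u ∈ A, μ 0 u) (∑ u ∈ Aᶜ, μ 0 u) :=
    le_min (sum_nonneg fun u _ => (hμ 0 u).le) (sum_nonneg fun u _ => (hμ 0 u).le)
  have hp'0 : 0 ≤ p' * θ := hmin0.trans hmin
  rw [div_le_div_iff₀ (by positivity) (by positivity)]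
  have hnum : t * ((univ.filter fun r : Fin m =>
      ((fun r : Fin m => (((0 : Fin (K + 1)), (κ r).succ) : Fin (K + 1) × Fin (K + 1))) r).1 = 0 ∨
        ((fun r : Fin m => (((0 : Fin (K + 1)), (κ r).succ) : Fin (K + 1) × Fin (K + 1))) r).2 = 0).card : ℝ)
      * min (∑ u ∈ A, μ 0 u) (∑ u ∈ Aᶜ, μ 0 u) ≤ t * m * (p' * θ) := by
    have := mul_le_mul hdeg hmin hmin0 hmpos.le
    calc t * _ * min (∑ u ∈ A, μ 0 u) (∑ u ∈ Aᶜ, μ 0 u) = t * (_ * min (∑ u ∈ A, μ 0 u) (∑ u ∈ Aᶜ, μ 0 u)) := by ring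
      _ ≤ t * (m * (p' * θ)) := mul_le_mul_of_nonneg_left this ht0
      _ = t * m * (p' * θ) := by ring
  calc t * _ * min (∑ u ∈ A, μ 0 u) (∑ u ∈ Aᶜ, μ 0 u) * (K * (1 - θ))
      ≤ t * m * (p' * θ) * (K * (1 - θ)) := mul_le_mul_of_nonneg_right hnum (by positivity)
    _ = t * p' * (m * K * (θ * (1 - θ))) := by ring

/-- **THE REFRESH CEILING AT A TIGHT SECTOR: `Gap ≤ (1−t)w_0·p'/(K(1−θ))`** — chapter K's full sector count: the swaps keep the count,
the sector-idle cold kernels do not move it, only the exact hot redraw mints labels (`Q_0(A,Aᶜ) = μ_0(A)μ_0(Aᶜ) ≤ p'θ`), against the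
variance `Σ_k μ_k(A)μ_k(Aᶜ) ≥ Kθ(1−θ)` of the count. [ours] -/
theorem tightSector_spectralGap_le_hot [Nontrivial S] (hK : 1 ≤ K) (hμ : ∀ k x, 0 < μ k x)
    (hμ1 : ∀ k, ∑ u, μ k u = 1) (hM : ∀ k, IsRowStochastic (M k)) (hMrev : ∀ k, DetailedBalance (μ k) (M k))
    (hM0 : ∀ u v, M 0 u v = μ 0 v) (hw0 : ∀ k, 0 ≤ w k) (hw1 : ∑ k, w k = 1) (ht0 : 0 ≤ t) (ht1 : t ≤ 1)
    {A : Finset S} (hφA : ∀ r u, φ r u ∈ A ↔ u ∈ A) {θ p' : ℝ} (hθ0 : 0 < θ) (hθ1 : θ < 1)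
    (hcold : ∀ k : Fin (K + 1), k ≠ 0 → ∑ u ∈ A, μ k u = θ) (hhot : ∑ u ∈ A, μ 0 u ≤ p' * θ)
    (hidle : ∀ k : Fin (K + 1), k ≠ 0 → w k * edgeMeasure (μ k) (M k) A Aᶜ = 0) :
    spectralGap (tensorFun μ) (fun y z : Fin (K + 1) → S =>
        t * ptGraphSwap μ (fun r : Fin m => (((0 : Fin (K + 1)), (κ r).succ) : Fin (K + 1) × Fin (K + 1))) φ y z
          + (1 - t) * prodKernel w M y z) ≤ (1 - t) * w 0 * p' / (K * (1 - θ)) := by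
  have hKpos : (0 : ℝ) < K := Nat.cast_pos.mpr (by omega)
  have h1θ : 0 < 1 - θ := by linarith
  have h1t : 0 ≤ 1 - t := by linarith
  set e : Fin m → Fin (K + 1) × Fin (K + 1) := fun r => (((0 : Fin (K + 1)), (κ r).succ) : Fin (K + 1) × Fin (K + 1))
    with he_def
  have he : ∀ r, (e r).1 ≠ (e r).2 := fun r => (Fin.succ_ne_zero (κ r)).symm
  have hQ := ptGraphSwap_isRowStochastic (e := e) (φ := φ) hμ
  have hQrev := ptGraphSwap_detailedBalance (e := e) (φ := φ) hμ
  have hQA := ptGraphSwap_sectorCount_eq (μ := μ) he hμ hφA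
  -- the variance of the full count: `Σ_k μ_k(A)μ_k(Aᶜ) ≥ K·θ(1−θ)` (drop the hot level)
  have hbal0 : 0 ≤ (∑ u ∈ A, μ 0 u) * ∑ u ∈ Aᶜ, μ 0 u :=
    mul_nonneg (sum_nonneg fun u _ => (hμ 0 u).le) (sum_nonneg fun u _ => (hμ 0 u).le)
  have hV : (K : ℝ) * (θ * (1 - θ)) ≤ ∑ k : Fin (K + 1), (∑ u ∈ A, μ k u) * ∑ u ∈ Aᶜ, μ k u := by
    rw [Fin.sum_univ_succ]
    have hc : ∑ k : Fin K, (∑ u ∈ A, μ k.succ u) * ∑ u ∈ Aᶜ, μ k.succ u = K * (θ * (1 - θ)) := by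
      rw [sum_congr rfl fun k _ => tightSector_coldBalance_eq hμ1 hcold k.succ (Fin.succ_ne_zero k), sum_const,
        Finset.card_univ, Fintype.card_fin, nsmul_eq_mul]
    rw [hc]
    linarith
  have hVpos : 0 < ∑ k : Fin (K + 1), (∑ u ∈ A, μ k u) * ∑ u ∈ Aᶜ, μ k u :=
    lt_of_lt_of_le (mul_pos hKpos (mul_pos hθ0 h1θ)) hV
  have h := weightedScheme_spectralGap_le_sectorCount (w := w) hμ hμ1 hM hMrev hw0 hw1 ht0 ht1 hQ hQrev hQA hVpos
  have hsum : ∑ k : Fin (K + 1), w k * edgeMeasure (μ k) (M k) A Aᶜ = w 0 * ((∑ u ∈ A, μ 0 u) * ∑ u ∈ Aᶜ, μ 0 u) := by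
    rw [Finset.sum_eq_single (0 : Fin (K + 1)) (fun k _ hk => hidle k hk) (fun h => absurd (mem_univ _) h),
      exactSampler_edgeMeasure hM0 A]
  rw [hsum] at h
  refine h.trans ?_
  -- `μ_0(A)μ_0(Aᶜ) ≤ p'θ·1`
  have hAc1 : ∑ u ∈ Aᶜ, μ 0 u ≤ 1 := by
    have hs : ∑ u ∈ A, μ 0 u + ∑ u ∈ Aᶜ, μ 0 u = 1 := by rw [Finset.sum_add_sum_compl, hμ1 0]
    linarith [sum_nonneg fun u (_ : u ∈ A) => (hμ 0 u).le]
  have hQ0 : (∑ u ∈ A, μ 0 u) * ∑ u ∈ Aᶜ, μ 0 u ≤ p' * θ := by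
    calc (∑ u ∈ A, μ 0 u) * ∑ u ∈ Aᶜ, μ 0 u ≤ (∑ u ∈ A, μ 0 u) * 1 :=
          mul_le_mul_of_nonneg_left hAc1 (sum_nonneg fun u _ => (hμ 0 u).le)
      _ ≤ p' * θ := by rw [mul_one]; exact hhot
  have hnum0 : 0 ≤ (1 - t) * (w 0 * ((∑ u ∈ A, μ 0 u) * ∑ u ∈ Aᶜ, μ 0 u)) := mul_nonneg h1t (mul_nonneg (hw0 0) hbal0)
  calc (1 - t) * (w 0 * ((∑ u ∈ A, μ 0 u) * ∑ u ∈ Aᶜ, μ 0 u)) / ∑ k : Fin (K + 1), (∑ u ∈ A, μ k u) * ∑ u ∈ Aᶜ, μ k u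
      ≤ (1 - t) * (w 0 * ((∑ u ∈ A, μ 0 u) * ∑ u ∈ Aᶜ, μ 0 u)) / (K * (θ * (1 - θ))) :=
        div_le_div_of_nonneg_left hnum0 (by positivity) hV
    _ ≤ (1 - t) * (w 0 * (p' * θ)) / (K * (θ * (1 - θ))) :=
        div_le_div_of_nonneg_right (mul_le_mul_of_nonneg_left (mul_le_mul_of_nonneg_left hQ0 (hw0 0)) h1t) (by positivity)
    _ = (1 - t) * w 0 * p' / (K * (1 - θ)) := by
        field_simp

/-! ## §2 The two-sided law -/

/-- **THE MAP QUALITY IS PAID EXACTLY ONCE (THE TWO-SIDED GAP LAW AT A TIGHT SECTOR).**  Exact hot redraws, one-sided transported domination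
`p·μ_{κ_r+1}(φ_r u) ≤ μ_0(u)` (`0 < p ≤ 1`), every cold level listed `≥ c ≥ 1` times, entry maps preserving `A`, every cold level giving `A`
mass `θ ∈ (0,1)`, the hot level at most `p'θ`, sector-idle `μ_k`-reversible cold kernels, `0 < t < 1`, `w ≥ 0`, `Σw = 1`, `w_0 > 0`:
**`p·min{ct/(3m), (1−t)w_0/(7K)} ≤ Gap ≤ (p'/(K(1−θ)))·min{t, (1−t)w_0}`** (and `p ≤ p'`, §0). [ours] -/
theorem tightSector_spectralGap_two_sided [Nontrivial S] (hK : 1 ≤ K) (hm : 1 ≤ m) (ht0 : 0 < t) (ht1 : t < 1)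
    (hw0 : ∀ k, 0 ≤ w k) (hw00 : 0 < w 0) (hw1 : ∑ k, w k = 1) (hμ : ∀ k x, 0 < μ k x)
    (hμ1 : ∀ k, ∑ u, μ k u = 1) (hM : ∀ k, IsRowStochastic (M k)) (hMrev : ∀ k, DetailedBalance (μ k) (M k))
    (hM0 : ∀ u v, M 0 u v = μ 0 v) (hp0 : 0 < p) (hp1 : p ≤ 1) (hdom : ∀ r u, p * μ (κ r).succ (φ r u) ≤ μ 0 u)
    {c : ℕ} (hc1 : 1 ≤ c) (hc : ∀ p' : Fin K, c ≤ (univ.filter (fun r : Fin m => κ r = p')).card)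
    {A : Finset S} (hφA : ∀ r u, φ r u ∈ A ↔ u ∈ A) {θ p' : ℝ} (hθ0 : 0 < θ) (hθ1 : θ < 1)
    (hcold : ∀ k : Fin (K + 1), k ≠ 0 → ∑ u ∈ A, μ k u = θ) (hhot : ∑ u ∈ A, μ 0 u ≤ p' * θ)
    (hidle : ∀ k : Fin (K + 1), k ≠ 0 → w k * edgeMeasure (μ k) (M k) A Aᶜ = 0) :
    p * min (c * t / (3 * m)) ((1 - t) * w 0 / (7 * K))
        ≤ spectralGap (tensorFun μ) (fun y z : Fin (K + 1) → S =>
            t * ptGraphSwap μ (fun r : Fin m => (((0 : Fin (K + 1)), (κ r).succ) : Fin (K + 1) × Fin (K + 1))) φ y z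
              + (1 - t) * prodKernel w M y z)
      ∧ spectralGap (tensorFun μ) (fun y z : Fin (K + 1) → S =>
            t * ptGraphSwap μ (fun r : Fin m => (((0 : Fin (K + 1)), (κ r).succ) : Fin (K + 1) × Fin (K + 1))) φ y z
              + (1 - t) * prodKernel w M y z)
        ≤ p' / (K * (1 - θ)) * min t ((1 - t) * w 0) := by
  have hKpos : (0 : ℝ) < K := Nat.cast_pos.mpr (by omega)
  have h1θ : 0 < 1 - θ := by linarith
  refine ⟨dominatedStar_spectralGap_ge_regimeFree κ φ hK hm ht0 ht1 hw0 hw00 hw1 hμ hμ1 hM hMrev hM0 hp0 hp1 hdom hc1 hc, ?_⟩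
  rw [mul_min_of_nonneg _ _ (div_nonneg ((hp0.le.trans (tightSector_floor_le_ceiling κ φ hm hdom hφA hθ0 hcold hhot)))
    (by positivity))]
  refine le_min ?_ ?_
  · have h := tightSector_spectralGap_le_swap κ φ hK hm hμ hμ1 hM hMrev hw0 hw1 ht0.le ht1.le hφA hθ0 hθ1 hcold hhot hidle
    calc _ ≤ t * p' / (K * (1 - θ)) := h
      _ = p' / (K * (1 - θ)) * t := by ring
  · have h := tightSector_spectralGap_le_hot κ φ hK hμ hμ1 hM hMrev hM0 hw0 hw1 ht0.le ht1.le hφA hθ0 hθ1 hcold hhot hidle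
    calc _ ≤ (1 - t) * w 0 * p' / (K * (1 - θ)) := h
      _ = p' / (K * (1 - θ)) * ((1 - t) * w 0) := by ring

/-- **UNIFORM LISTING (`m = cK`): `(p/K)·min{t/3, (1−t)w_0/7} ≤ Gap ≤ (p'/(K(1−θ)))·min{t, (1−t)w_0}`** — both sides linear in the map
quality and in `1/K`. [ours] -/
theorem uniformTightSector_spectralGap_two_sided [Nontrivial S] (hK : 1 ≤ K) (ht0 : 0 < t) (ht1 : t < 1)
    (hw0 : ∀ k, 0 ≤ w k) (hw00 : 0 < w 0) (hw1 : ∑ k, w k = 1) (hμ : ∀ k x, 0 < μ k x)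
    (hμ1 : ∀ k, ∑ u, μ k u = 1) (hM : ∀ k, IsRowStochastic (M k)) (hMrev : ∀ k, DetailedBalance (μ k) (M k))
    (hM0 : ∀ u v, M 0 u v = μ 0 v) (hp0 : 0 < p) (hp1 : p ≤ 1) (hdom : ∀ r u, p * μ (κ r).succ (φ r u) ≤ μ 0 u)
    {c : ℕ} (hc1 : 1 ≤ c) (hc : ∀ p' : Fin K, c ≤ (univ.filter (fun r : Fin m => κ r = p')).card) (hmc : m = c * K)
    {A : Finset S} (hφA : ∀ r u, φ r u ∈ A ↔ u ∈ A) {θ p' : ℝ} (hθ0 : 0 < θ) (hθ1 : θ < 1)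
    (hcold : ∀ k : Fin (K + 1), k ≠ 0 → ∑ u ∈ A, μ k u = θ) (hhot : ∑ u ∈ A, μ 0 u ≤ p' * θ)
    (hidle : ∀ k : Fin (K + 1), k ≠ 0 → w k * edgeMeasure (μ k) (M k) A Aᶜ = 0) :
    p / K * min (t / 3) ((1 - t) * w 0 / 7)
        ≤ spectralGap (tensorFun μ) (fun y z : Fin (K + 1) → S =>
            t * ptGraphSwap μ (fun r : Fin m => (((0 : Fin (K + 1)), (κ r).succ) : Fin (K + 1) × Fin (K + 1))) φ y z
              + (1 - t) * prodKernel w M y z)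
      ∧ spectralGap (tensorFun μ) (fun y z : Fin (K + 1) → S =>
            t * ptGraphSwap μ (fun r : Fin m => (((0 : Fin (K + 1)), (κ r).succ) : Fin (K + 1) × Fin (K + 1))) φ y z
              + (1 - t) * prodKernel w M y z)
        ≤ p' / (K * (1 - θ)) * min t ((1 - t) * w 0) := by
  have hm : 1 ≤ m := by rw [hmc]; exact Nat.one_le_iff_ne_zero.mpr (Nat.mul_ne_zero (by omega) (by omega))
  have hKpos : (0 : ℝ) < K := Nat.cast_pos.mpr (by omega)
  have hcpos : (0 : ℝ) < c := Nat.cast_pos.mpr (by omega)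
  have hmR : (m : ℝ) = c * K := by rw [hmc, Nat.cast_mul]
  obtain ⟨hlo, hhi⟩ := tightSector_spectralGap_two_sided κ φ hK hm ht0 ht1 hw0 hw00 hw1 hμ hμ1 hM hMrev hM0 hp0 hp1 hdom hc1 hc
    hφA hθ0 hθ1 hcold hhot hidle
  refine ⟨?_, hhi⟩
  have e : p * min (c * t / (3 * m)) ((1 - t) * w 0 / (7 * K)) = p / K * min (t / 3) ((1 - t) * w 0 / 7) := by
    have e1 : (c : ℝ) * t / (3 * m) = 1 / K * (t / 3) := by rw [hmR]; field_simp
    have e2 : (1 - t) * w 0 / (7 * K) = 1 / K * ((1 - t) * w 0 / 7) := by field_simp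
    rw [e1, e2, ← mul_min_of_nonneg _ _ (by positivity : (0 : ℝ) ≤ 1 / K)]
    ring
  rw [← e]; exact hlo

/-! ## §3 Relaxation time and cost, from both sides -/

/-- **`t_rel ≥ (1−θ)K/(p'·min{t, (1−t)w_0})`** at a tight sector (hypotheses of the law): `γ⋆ ≤ Gap` for the irreducible reversible scheme
(`Scaling/DominatedStarRegimeFreeAutocorrelation`), `γ⋆ > 0` (N4), and §2. [ours] -/
theorem tightSector_relaxationTime_ge [Nontrivial S] (hK : 1 ≤ K) (hm : 1 ≤ m) (ht0 : 0 < t) (ht1 : t < 1)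
    (hw0 : ∀ k, 0 ≤ w k) (hw00 : 0 < w 0) (hw1 : ∑ k, w k = 1) (hμ : ∀ k x, 0 < μ k x)
    (hμ1 : ∀ k, ∑ u, μ k u = 1) (hM : ∀ k, IsRowStochastic (M k)) (hMrev : ∀ k, DetailedBalance (μ k) (M k))
    (hM0 : ∀ u v, M 0 u v = μ 0 v) (hp0 : 0 < p) (hp1 : p ≤ 1) (hdom : ∀ r u, p * μ (κ r).succ (φ r u) ≤ μ 0 u)
    {c : ℕ} (hc1 : 1 ≤ c) (hc : ∀ p' : Fin K, c ≤ (univ.filter (fun r : Fin m => κ r = p')).card)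
    {A : Finset S} (hφA : ∀ r u, φ r u ∈ A ↔ u ∈ A) {θ p' : ℝ} (hθ0 : 0 < θ) (hθ1 : θ < 1)
    (hcold : ∀ k : Fin (K + 1), k ≠ 0 → ∑ u ∈ A, μ k u = θ) (hhot : ∑ u ∈ A, μ 0 u ≤ p' * θ)
    (hidle : ∀ k : Fin (K + 1), k ≠ 0 → w k * edgeMeasure (μ k) (M k) A Aᶜ = 0) :
    (1 - θ) * K / (p' * min t ((1 - t) * w 0))
      ≤ relaxationTime (fun y z : Fin (K + 1) → S =>
            t * ptGraphSwap μ (fun r : Fin m => (((0 : Fin (K + 1)), (κ r).succ) : Fin (K + 1) × Fin (K + 1))) φ y z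
              + (1 - t) * prodKernel w M y z) := by
  have hKpos : (0 : ℝ) < K := Nat.cast_pos.mpr (by omega)
  have hmpos : (0 : ℝ) < m := Nat.cast_pos.mpr (by omega)
  have hcpos : (0 : ℝ) < c := Nat.cast_pos.mpr (by omega)
  have h1θ : 0 < 1 - θ := by linarith
  have h1t : 0 < 1 - t := by linarith
  have hpp' : p ≤ p' := tightSector_floor_le_ceiling κ φ hm hdom hφA hθ0 hcold hhot
  have hp'0 : 0 < p' := lt_of_lt_of_le hp0 hpp'
  set e : Fin m → Fin (K + 1) × Fin (K + 1) := fun r => (((0 : Fin (K + 1)), (κ r).succ) : Fin (K + 1) × Fin (K + 1))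
    with he_def
  set P : (Fin (K + 1) → S) → (Fin (K + 1) → S) → ℝ := fun y z => t * ptGraphSwap μ e φ y z + (1 - t) * prodKernel w M y z
    with hPdef
  -- `0 < γ⋆ ≤ Gap ≤ ceiling`
  have hγpos : 0 < absSpectralGap P := by
    have h := dominatedStar_absSpectralGap_ge_regimeFree κ φ hK hm ht0 ht1 hw0 hw00 hw1 hμ hμ1 hM hMrev hM0 hp0 hp1 hdom hc1 hc
    exact lt_of_lt_of_le (mul_pos hp0 (lt_min (by positivity) (by positivity))) h
  have hirr := dominatedStar_isIrreducible_regimeFree κ φ ht0 ht1 hw0 hw00 hw1 hμ hM hM0 hc1 hc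
  have hPst : IsRowStochastic P :=
    weightedScheme_isRowStochastic (ptGraphSwap_isRowStochastic (e := e) (φ := φ) hμ) hM hw0 hw1 ht0.le ht1.le
  have hDB : DetailedBalance (tensorFun μ) P :=
    weightedScheme_detailedBalance (w := w) (ptGraphSwap_detailedBalance (e := e) (φ := φ) hμ) hMrev t
  have hγle : absSpectralGap P ≤ spectralGap (tensorFun μ) P :=
    absSpectralGap_le_spectralGap (tensorFun_pos hμ) (sum_tensorFun_eq_one μ hμ1) hPst hDB hirr
  have hceil := (tightSector_spectralGap_two_sided κ φ hK hm ht0 ht1 hw0 hw00 hw1 hμ hμ1 hM hMrev hM0 hp0 hp1 hdom hc1 hc hφA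
    hθ0 hθ1 hcold hhot hidle).2
  have hminpos : 0 < min t ((1 - t) * w 0) := lt_min ht0 (by positivity)
  have hbpos : 0 < p' / (K * (1 - θ)) * min t ((1 - t) * w 0) := by positivity
  unfold relaxationTime
  rw [div_le_div_iff₀ (by positivity) hγpos]
  calc (1 - θ) * K * absSpectralGap P ≤ (1 - θ) * K * (p' / (K * (1 - θ)) * min t ((1 - t) * w 0)) :=
        mul_le_mul_of_nonneg_left (hγle.trans hceil) (by positivity)
    _ = 1 * (p' * min t ((1 - t) * w 0)) := by field_simp

/-- **THE COST OF ONE RELAXATION TIME AT HALF SWAPS, LINEAR IN THE QUALITY FROM BOTH SIDES** (`t = ½`, `w_0 = 1`, `m = cK`, a swap test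
costs `κ_s ≥ 0`, the exact hot draw `κ_u ≥ 0`, cold updates carry weight `0`; tight sector as in the law):
**`(1−θ)K(κ_s+κ_u)/p' ≤ ((κ_s+κ_u)/2)·t_rel ≤ 7K(κ_s+κ_u)/p`** (§3 and `Scaling/DominatedStarRegimeFreeCost`). [ours] -/
theorem halfStar_tightSector_relaxationCost_two_sided [Nontrivial S] (hK : 1 ≤ K) (hw0 : ∀ k, 0 ≤ w k) (hw01 : w 0 = 1)
    (hw1 : ∑ k, w k = 1) (hμ : ∀ k x, 0 < μ k x) (hμ1 : ∀ k, ∑ u, μ k u = 1) (hM : ∀ k, IsRowStochastic (M k))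
    (hMrev : ∀ k, DetailedBalance (μ k) (M k)) (hM0 : ∀ u v, M 0 u v = μ 0 v) (hp0 : 0 < p) (hp1 : p ≤ 1)
    (hdom : ∀ r u, p * μ (κ r).succ (φ r u) ≤ μ 0 u)
    {c : ℕ} (hc1 : 1 ≤ c) (hc : ∀ p' : Fin K, c ≤ (univ.filter (fun r : Fin m => κ r = p')).card) (hmc : m = c * K)
    {A : Finset S} (hφA : ∀ r u, φ r u ∈ A ↔ u ∈ A) {θ p' : ℝ} (hθ0 : 0 < θ) (hθ1 : θ < 1)
    (hcold : ∀ k : Fin (K + 1), k ≠ 0 → ∑ u ∈ A, μ k u = θ) (hhot : ∑ u ∈ A, μ 0 u ≤ p' * θ)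
    (hidle : ∀ k : Fin (K + 1), k ≠ 0 → w k * edgeMeasure (μ k) (M k) A Aᶜ = 0)
    {κs κu : ℝ} (hκs : 0 ≤ κs) (hκu : 0 ≤ κu) :
    (1 - θ) * K * (κs + κu) / p'
        ≤ ((κs + κu) / 2) * relaxationTime (fun y z : Fin (K + 1) → S =>
            (1 / 2 : ℝ) * ptGraphSwap μ (fun r : Fin m => (((0 : Fin (K + 1)), (κ r).succ) : Fin (K + 1) × Fin (K + 1))) φ y z
              + (1 - 1 / 2) * prodKernel w M y z)
      ∧ ((κs + κu) / 2) * relaxationTime (fun y z : Fin (K + 1) → S =>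
            (1 / 2 : ℝ) * ptGraphSwap μ (fun r : Fin m => (((0 : Fin (K + 1)), (κ r).succ) : Fin (K + 1) × Fin (K + 1))) φ y z
              + (1 - 1 / 2) * prodKernel w M y z)
          ≤ 7 * K * (κs + κu) / p := by
  have hm : 1 ≤ m := by rw [hmc]; exact Nat.one_le_iff_ne_zero.mpr (Nat.mul_ne_zero (by omega) (by omega))
  have hKpos : (0 : ℝ) < K := Nat.cast_pos.mpr (by omega)
  have hcpos : (0 : ℝ) < c := Nat.cast_pos.mpr (by omega)
  have hmR : (m : ℝ) = c * K := by rw [hmc, Nat.cast_mul]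
  have h1θ : 0 < 1 - θ := by linarith
  have hw00 : 0 < w 0 := by rw [hw01]; exact one_pos
  have hpp' : p ≤ p' := tightSector_floor_le_ceiling κ φ hm hdom hφA hθ0 hcold hhot
  have hp'0 : 0 < p' := lt_of_lt_of_le hp0 hpp'
  refine ⟨?_, halfStar_relaxationCost_le κ φ hK hm hw0 hw01 hw1 hμ hμ1 hM hMrev hM0 hp0 hp1 hdom hc1 hc hmR.le hκs hκu⟩
  have hrel := tightSector_relaxationTime_ge κ φ hK hm (t := 1 / 2) (by norm_num) (by norm_num) hw0 hw00 hw1 hμ hμ1 hM hMrev hM0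
    hp0 hp1 hdom hc1 hc hφA hθ0 hθ1 hcold hhot hidle
  have hmin : min (1 / 2 : ℝ) ((1 - 1 / 2) * w 0) = 1 / 2 := by rw [hw01]; norm_num
  rw [hmin] at hrel
  have e : (1 - θ) * K * (κs + κu) / p' = ((κs + κu) / 2) * ((1 - θ) * K / (p' * (1 / 2))) := by
    field_simp
  rw [e]
  exact mul_le_mul_of_nonneg_left hrel (by positivity)

end Sector

end Summit.Ventures.LatticeQCDFlow.Scaling

end
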